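import Literature.Computability.MetaComplexity.EFModMulUComm
import HarnessLib

/-!
# Commutativity of uniform modular multiplication, part B1: the word facts of a stage

Layer E/6 (uniform variant). For stage `s` of the commutativity kit (`ModMulU.Comm.commT`),
the facts about the words `B_s = b >> (L - s)`, `R(B_s ⊕ B_s)` (the modular adder `MS` of
`LD1_s`), `u_s` and `R(R(B_s ⊕ B_s) ⊕ u_s)` (the `MS` of `LD2_s`): both sums are below `n`
(domination by `B_{s+1} < n`), so no modular reduction happens, `R(B_s ⊕ B_s)` is `B_{s+1}` with
bit `0` cleared and `R(R(B_s ⊕ B_s) ⊕ u_s) ≡ B_{s+1}` bitwise; the comparators of `LD2_s`'s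
`VX`, `VY` answer `<`; the comparators of `LD1_s`'s `VX`, `VY` and of `M_s`, `M_{s+1}` receive
their facts by transfer. One block `ModMulU.Comm.F.isBlock_segs`.

## Sources

* S. A. Cook, R. A. Reckhow, *The relative efficiency of propositional proof systems*,
  J. Symbolic Logic 44 (1979), §2.
-/

namespace Literature.Computability.MetaComplexity

open _root_.Computability Complexity Complexity.PropForm Netlist Cluster FregeSystem

namespace ModMulU

namespace Comm

/-! ### Rules -/

/-- `s ↔ x` gives `¬s ∨ x`. [cite: CookReckhow1979, §2 (sound rule)] -/
def rImpOfBiimp : FregeRule := ⟨[ctx (var 0) (eqv 1 2)], ctx (var 0) (disj (neg (var 1)) (var 2))⟩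
/-- `R ↔ mux(g, d, s)`, `¬g`, `s ↔ x` give `R ↔ x`. [cite: CookReckhow1979, §2 (sound rule)] -/
def rMuxFChain : FregeRule :=
  ⟨[ctx (var 0) (biimp (var 1) (muxF (var 2) (var 3) (var 4))), ctx (var 0) (neg (var 2)), ctx (var 0) (eqv 4 5)], ctx (var 0) (eqv 1 5)⟩

/-- The rules of the commutativity law. [cite: CookReckhow1979, §2] -/
def rules : List FregeRule := [rImpOfBiimp, rMuxFChain]

/-- Every rule is sound. [cite: CookReckhow1979, §2 (sound rule)] -/
theorem isSound_of_mem_rules : ∀ r ∈ rules, r.IsSound := by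
  intro r hr
  simp only [rules, List.mem_cons, List.not_mem_nil, or_false] at hr
  rcases hr with rfl | rfl <;> exact FregeRule.isSound_of_check (by decide +kernel)

/-- Inference by rule number `i`. [folklore] -/
theorem infer {G : FregeSystem} (hG : ∀ r ∈ rules, r ∈ G.rules) (i : ℕ) (hi : i < rules.length) {S : Set (PropForm ℕ)}
    (σ : ℕ → PropForm ℕ) {φ : PropForm ℕ} (hφ : (rules[i]).conclusion.subst σ = φ)
    (hp : ∀ ψ ∈ (rules[i]).premises, ψ.subst σ ∈ S) : G.IsInferredFrom S φ :=
  hφ ▸ FregeSystem.IsInferredFrom.of_rule (hG _ (List.getElem_mem hi)) σ rfl hp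

/-! ### Canonical views of stage `s` -/

section Views

variable (L : ℕ) (o : Occ) (s : ℕ)

/-- `B_s`. [folklore] -/
def B : ℕ → ℕ := Bw L o (L - s)
/-- `B_{s+1}`. [folklore] -/
def B' : ℕ → ℕ := Bw L o (L - s - 1)
/-- The modular adder `B_s ⊕ B_s` (the `MS` of `LD1_s`), canonical operands. [folklore] -/
def MS1 : ModAddU.View := ⟨(LD1 L o s).base, B L o s, B L o s, nv L o⟩
/-- `R(B_s ⊕ B_s)`. [folklore] -/
def R1 : ℕ → ℕ := (MS1 L o s).R L
/-- The modular adder `R(B_s ⊕ B_s) ⊕ u_s` (the `MS` of `LD2_s`), canonical operands. [folklore] -/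
def MS2 : ModAddU.View := ⟨(LD2 L o s).base, R1 L o s, uw L o s, nv L o⟩
/-- `R(R(B_s ⊕ B_s) ⊕ u_s)`. [folklore] -/
def R2 : ℕ → ℕ := (MS2 L o s).R L
/-- The comparator of `Bw k` with `n`: the consumer-side `(b, n)` for `k = 0`, else shift kit `k - 1` of `b`'s chain. [folklore] -/
def CAB (k : ℕ) : Sub.View := One.CA L (ShB L o) (o.base + (3 * L + 1)) k
/-- The comparator of `LD2_s`'s `VX` (`R(B_s ⊕ B_s)` with `n`), canonical. [folklore] -/
def CX2 : Sub.View := ⟨(LD.VX L (LD2 L o s)).rbase L 1, R1 L o s, nv L o⟩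
/-- The comparator of `LD2_s`'s `VY` (`u_s` with `n`), canonical. [folklore] -/
def CY2 : Sub.View := ⟨(LD.VY L (LD2 L o s)).rbase L 1, uw L o s, nv L o⟩
/-- The comparator of `LD1_s`'s `VX` (`B_s` with `n`), canonical. [folklore] -/
def CX1 : Sub.View := ⟨(LD.VX L (LD1 L o s)).rbase L 1, B L o s, nv L o⟩
/-- The comparator of `LD1_s`'s `VY`, canonical. [folklore] -/
def CY1 : Sub.View := ⟨(LD.VY L (LD1 L o s)).rbase L 1, B L o s, nv L o⟩

end Views

variable {L : ℕ} {o : Occ} {K : PropForm ℕ} {G : FregeSystem}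

/-- `Bw` shifts: bit `i` of `Bw (k + 1)` is bit `i + 1` of `Bw k`. [folklore] -/
theorem Bw_succ {k i : ℕ} : Bw L o k (i + 1) = Bw L o (k + 1) i := by
  unfold Bw; simp only [show i + 1 + k = i + (k + 1) by omega]

/-- Bit `0` of `Bw k`. [folklore] -/
theorem Bw_zero_idx {k : ℕ} (hk : k < L) : Bw L o k 0 = o.inp (L + k) := by unfold Bw; rw [if_pos (by omega), Nat.zero_add]

/-- `Bw L` is the zero word. [folklore] -/
theorem Bw_L {i : ℕ} : Bw L o L i = zv L o := by unfold Bw zv; rw [if_neg (by omega)]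

/-- `Bw 0` is `b`. [folklore] -/
theorem Bw_zero {i : ℕ} (hi : i < L) : Bw L o 0 i = o.inp (L + i) := by unfold Bw; rw [if_pos (by omega), Nat.add_zero]

/-- `u_s` above bit `0` is the zero gate. [folklore] -/
theorem uw_succ {s i : ℕ} : uw L o s (i + 1) = zv L o := rfl

/-- Bit `0` of `u_s`. [folklore] -/
theorem uw_zero {s : ℕ} : uw L o s 0 = o.inp (L + (L - 1 - s)) := rfl

/-- The shifted words of `b`'s chain are the `Bw`. [folklore] -/
theorem Aw_ShB {k i : ℕ} : One.Aw L (ShB L o) k i = Bw L o k i := by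
  unfold One.Aw Bw
  by_cases h : i + k < L
  · rw [if_pos h, if_pos h, ShB_inp (by omega), if_pos (by omega), show L + (i + k) = L + (i + k) from rfl]
  · rw [if_neg h, if_neg h, ShB_inp (by omega), if_neg (by omega)]

/-- The modulus of `b`'s chain. [folklore] -/
theorem nw_ShB {i : ℕ} (hi : i < L) : One.nw L (ShB L o) i = nv L o i := by
  unfold One.nw nv; rw [ShB_inp (by omega), if_pos (by omega)]; congr 1; omega

/-! ### The segments of the word facts -/

section Segs

variable (L : ℕ) (o : Occ) (K : PropForm ℕ) (s : ℕ)

/-- The segments. [folklore] -/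
def segs : List (List (PropForm ℕ)) :=
  let S1 := (MS1 L o s).S
  let D1 := (MS1 L o s).D L
  let S2 := (MS2 L o s).S
  let D2 := (MS2 L o s).D L
  [(List.range L).map (fun i => ctx K (eqv (S1.c (i + 1)) (B L o s i))),                                -- 0
   (List.range L).map (fun i => ctx K (eqv (S1.s i) (S1.c i))),                                        -- 1
   [ctx K (neg (var (S1.s 0)))],                                                                        -- 2
   (List.range (L - 1)).map (fun i => ctx K (eqv (S1.s (i + 1)) (B' L o s (i + 1)))),                  -- 3
   (List.range L).map (fun i => ctx K (disj (neg (var (S1.s i))) (var (B' L o s i)))),                  -- 4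
   Shift.monoLines (CAB L o (L - s - 1)) D1 K L,                                                        -- 5
   [ctx K (neg (var (R1 L o s 0)))],                                                                    -- 6
   (List.range (L - 1)).map (fun i => ctx K (eqv (R1 L o s (i + 1)) (B' L o s (i + 1)))),              -- 7
   (List.range L).map (fun i => ctx K (neg (conj (var (R1 L o s i)) (var (uw L o s i))))),              -- 8
   Shift.dorLines S2 K L,                                                                               -- 9
   [ctx K (eqv (S2.s 0) (uw L o s 0))],                                                                 -- 10
   (List.range (L - 1)).map (fun i => ctx K (eqv (S2.s (i + 1)) (R1 L o s (i + 1)))),                  -- 11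
   (List.range L).map (fun i => ctx K (eqv (S2.s i) (B' L o s i))),                                    -- 12
   (List.range L).map (fun i => ctx K (disj (neg (var (S2.s i))) (var (B' L o s i)))),                  -- 13
   Shift.monoLines (CAB L o (L - s - 1)) D2 K L,                                                        -- 14
   (List.range L).map (fun i => ctx K (eqv (R2 L o s i) (B' L o s i))),                                 -- 15
   (List.range L).map (fun i => ctx K (disj (neg (var (R1 L o s i))) (var (B' L o s i)))),              -- 16
   Shift.monoLines (CAB L o (L - s - 1)) (CX2 L o s) K L,                                               -- 17
   (List.range L).map (fun i => ctx K (disj (neg (var (uw L o s i))) (var (B' L o s i)))),              -- 18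
   Shift.monoLines (CAB L o (L - s - 1)) (CY2 L o s) K L,                                               -- 19
   ModAddU.AssocKit.transferLines (CAB L o (L - s)) (CX1 L o s) K L,                                    -- 20
   ModAddU.AssocKit.transferLines (CAB L o (L - s)) (CY1 L o s) K L,                                    -- 21
   ModAddU.AssocKit.transferLines (CmpA L o) ((M L o s).CA L) K L,                                      -- 22
   ModAddU.AssocKit.transferLines (CmpA L o) ((M L o (s + 1)).CA L) K L]                                -- 23

end Segs

/-- The length of the segment list. [folklore] -/
theorem length_segs (L : ℕ) (o : Occ) (K : PropForm ℕ) (s : ℕ) : (segs L o K s).length = 24 := rfl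

variable {T : Set (PropForm ℕ)}

/-- Availability of the canonical adders and comparators of stage `s`. [folklore] -/
theorem avail_canon (hL : 0 < L) (h : CAvail L o K T) {s : ℕ} (hs : s < L) :
    (MS1 L o s).Avail K T L ∧ (MS2 L o s).Avail K T L ∧ (CX2 L o s).Avail K T L ∧ (CY2 L o s).Avail K T L ∧
      (CX1 L o s).Avail K T L ∧ (CY1 L o s).Avail K T L := by
  have h1 := LD.avail_ofOcc (h.hLD1 s hs)
  have h2 := LD.avail_ofOcc (h.hLD2 s hs)
  refine ⟨?_, ?_, ?_, ?_, ?_, ?_⟩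
  · exact ModAddU.View.Avail.congr h1.hMS rfl (fun i hi => ((LD1_inp hs hi).1).symm) (fun i hi => ((LD1_inp hs hi).2.1).symm)
      (fun i hi => ((LD1_inp hs hi).2.2.2).symm)
  · exact ModAddU.View.Avail.congr h2.hMS rfl (fun i hi => ((LD2_inp hL hs hi).1).symm) (fun i hi => ((LD2_inp hL hs hi).2.1).symm)
      (fun i hi => ((LD2_inp hL hs hi).2.2.2).symm)
  · exact Sub.View.Avail.congr h2.hVX.hCA rfl (fun i hi => ((LD2_inp hL hs hi).1).symm) (fun i hi => ((LD2_inp hL hs hi).2.2.2).symm)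
  · exact Sub.View.Avail.congr h2.hVY.hCA rfl (fun i hi => ((LD2_inp hL hs hi).2.1).symm) (fun i hi => ((LD2_inp hL hs hi).2.2.2).symm)
  · exact Sub.View.Avail.congr h1.hVX.hCA rfl (fun i hi => ((LD1_inp hs hi).1).symm) (fun i hi => ((LD1_inp hs hi).2.2.2).symm)
  · exact Sub.View.Avail.congr h1.hVY.hCA rfl (fun i hi => ((LD1_inp hs hi).2.1).symm) (fun i hi => ((LD1_inp hs hi).2.2.2).symm)

/-- **The word facts of stage `s` form a block.** [cite: CookReckhow1979, §2] -/
theorem isBlock_segs (hGC : ∀ r ∈ rules, r ∈ G.rules) (hGO : ∀ r ∈ One.rules, r ∈ G.rules) (hGS : ∀ r ∈ Sys.glue, r ∈ G.rules)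
    (hGY : ∀ r ∈ Sys.sysRules, r ∈ G.rules) (hGN : ∀ r ∈ Netlist.rules, r ∈ G.rules) (hGA : ∀ r ∈ Adder.rules, r ∈ G.rules)
    (hGL : ∀ r ∈ Logic.rules, r ∈ G.rules) (hL : 0 < L) (h : CAvail L o K T) {s : ℕ} (hs : s < L)
    (hz : ctx K (neg (var (zv L o))) ∈ T) (hCAB : ∀ k ≤ L, (CAB L o k).Avail K T L)
    (hltB : ∀ k ≤ L, ctx K (neg (var ((CAB L o k).ge L L))) ∈ T) (hltA : ctx K (neg (var ((CmpA L o).ge L L))) ∈ T) :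
    G.IsBlock T (segs L o K s).flatten := by
  obtain ⟨hMS1, hMS2, hCX2, hCY2, hCX1, hCY1⟩ := avail_canon hL h hs
  have eB : ∀ i, B L o s i = B' L o s (i + 1) := fun i => by
    unfold B B'; rw [Bw_succ, show L - s - 1 + 1 = L - s by omega]
  have eB0 : B' L o s 0 = uw L o s 0 := by unfold B'; rw [Bw_zero_idx (by omega), uw_zero]; congr 1; omega
  refine ModAddU.AssocData.isBlock_flatten _ fun k hk => ?_
  rw [length_segs] at hk
  have mem : ∀ {χ} (j : ℕ) (hj : j < k) (hχ : χ ∈ (segs L o K s)[j]'(by rw [length_segs]; omega)),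
      χ ∈ T ∪ {χ | ∃ j, ∃ hj : j < k, χ ∈ (segs L o K s)[j]'(by rw [length_segs]; omega)} := fun j hj hχ => Or.inr ⟨j, hj, hχ⟩
  have hΓ : T ⊆ T ∪ {χ | ∃ j, ∃ hj : j < k, χ ∈ (segs L o K s)[j]'(by rw [length_segs]; omega)} := fun _ hχ => Or.inl hχ
  have mr : ∀ {f : ℕ → PropForm ℕ} {W i : ℕ}, i < W → f i ∈ (List.range W).map f := fun hi => List.mem_map.2 ⟨_, List.mem_range.2 hi, rfl⟩
  interval_cases k
  · -- 0: carries of `B ⊕ B`: `κ_{i+1} ↔ B i`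
    refine Scaffold.isBlock_of_forall fun θ hθ => ?_
    obtain ⟨i, hi, rfl⟩ := List.mem_map.1 hθ
    rw [List.mem_range] at hi
    refine Or.inr (Sys.glue_infer hGS 1 (by decide) (FregeSystem.sub [K, var ((MS1 L o s).S.c (i + 1)), var (B L o s i), var ((MS1 L o s).S.c i)])
      rfl fun ψ hψ => ?_)
    simp only [Sys.glue, List.getElem_cons_succ, List.getElem_cons_zero, Sys.rDblC, List.mem_singleton] at hψ
    subst hψ; exact hΓ (hMS1.1.2 i hi).2
  · -- 1: sums: `s_i ↔ κ_i`
    refine Scaffold.isBlock_of_forall fun θ hθ => ?_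
    obtain ⟨i, hi, rfl⟩ := List.mem_map.1 hθ
    rw [List.mem_range] at hi
    refine Or.inr (Sys.glue_infer hGS 0 (by decide) (FregeSystem.sub [K, var ((MS1 L o s).S.s i), var (B L o s i), var ((MS1 L o s).S.c i)])
      rfl fun ψ hψ => ?_)
    simp only [Sys.glue, List.getElem_cons_zero, Sys.rDblS, List.mem_singleton] at hψ
    subst hψ; exact hΓ (hMS1.1.2 i hi).1
  · -- 2: `¬s_0`
    refine FregeSystem.IsBlock.singleton (Or.inr (One.infer hGO 2 (by decide) (FregeSystem.sub [K, var ((MS1 L o s).S.s 0), var ((MS1 L o s).S.c 0)])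
      rfl fun ψ hψ => ?_))
    simp only [One.rules, List.getElem_cons_succ, List.getElem_cons_zero, One.rNotS0, List.mem_cons, List.not_mem_nil, or_false] at hψ
    rcases hψ with rfl | rfl
    · exact mem 1 (by omega) (mr hL)
    · exact hΓ hMS1.1.1
  · -- 3: `s_{i+1} ↔ B' (i+1)`
    refine Scaffold.isBlock_of_forall fun θ hθ => ?_
    obtain ⟨i, hi, rfl⟩ := List.mem_map.1 hθ
    rw [List.mem_range] at hi
    refine Or.inr (Logic.infer hGL 6 (by decide) (FregeSystem.sub [K, var ((MS1 L o s).S.s (i + 1)), var ((MS1 L o s).S.c (i + 1)),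
      var (B' L o s (i + 1))]) rfl (FregeSystem.prems_cons (mem 1 (by omega) (mr (by omega))) (FregeSystem.prems_cons ?_ FregeSystem.prems_nil)))
    rw [← eB]; exact mem 0 (by omega) (mr (by omega))
  · -- 4: domination premises for the sum word of `B ⊕ B`
    refine Scaffold.isBlock_of_forall fun θ hθ => ?_
    obtain ⟨i, hi, rfl⟩ := List.mem_map.1 hθ
    rw [List.mem_range] at hi
    rcases Nat.eq_zero_or_pos i with rfl | hi0
    · refine Or.inr (One.infer hGO 3 (by decide) (FregeSystem.sub [K, var ((MS1 L o s).S.s 0), var (B' L o s 0)]) rfl fun ψ hψ => ?_)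
      simp only [One.rules, List.getElem_cons_succ, List.getElem_cons_zero, One.rImpOfNeg, List.mem_singleton] at hψ
      subst hψ; exact mem 2 (by omega) (List.mem_singleton_self _)
    · obtain ⟨j, rfl⟩ : ∃ j, i = j + 1 := ⟨i - 1, by omega⟩
      refine Or.inr (infer hGC 0 (by decide) (FregeSystem.sub [K, var ((MS1 L o s).S.s (j + 1)), var (B' L o s (j + 1))]) rfl fun ψ hψ => ?_)
      simp only [rules, List.getElem_cons_zero, rImpOfBiimp, List.mem_singleton] at hψ
      subst hψ; exact mem 3 (by omega) (mr (by omega))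
  · -- 5: `¬ge(B ⊕ B)` by domination
    exact Shift.isBlock_monoLines hGY ((hCAB _ (by omega)).mono hΓ) (hMS1.2.1.mono hΓ) (fun i hi => (nw_ShB hi).symm)
      (fun i hi => by rw [show (CAB L o (L - s - 1)).x i = B' L o s i from Aw_ShB]; exact mem 4 (by omega) (mr hi)) (hΓ (hltB _ (by omega)))
  · -- 6: `¬R1 0`
    refine FregeSystem.IsBlock.singleton (Or.inr (One.infer hGO 9 (by decide) (FregeSystem.sub [K, var (R1 L o s 0), var ((MS1 L o s).ge L),
      var ((MS1 L o s).d L 0), var ((MS1 L o s).S.s 0)]) rfl fun ψ hψ => ?_))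
    simp only [One.rules, List.getElem_cons_succ, List.getElem_cons_zero, One.rMuxFNot, List.mem_cons, List.not_mem_nil, or_false] at hψ
    rcases hψ with rfl | rfl | rfl
    · exact hΓ (hMS1.2.2 0 hL)
    · exact mem 5 (by omega) (Shift.mem_monoLines _ _ _ _)
    · exact mem 2 (by omega) (List.mem_singleton_self _)
  · -- 7: `R1 (i+1) ↔ B' (i+1)`
    refine Scaffold.isBlock_of_forall fun θ hθ => ?_
    obtain ⟨i, hi, rfl⟩ := List.mem_map.1 hθ
    rw [List.mem_range] at hi
    refine Or.inr (infer hGC 1 (by decide) (FregeSystem.sub [K, var (R1 L o s (i + 1)), var ((MS1 L o s).ge L),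
      var ((MS1 L o s).d L (i + 1)), var ((MS1 L o s).S.s (i + 1)), var (B' L o s (i + 1))]) rfl fun ψ hψ => ?_)
    simp only [rules, List.getElem_cons_succ, List.getElem_cons_zero, rMuxFChain, List.mem_cons, List.not_mem_nil, or_false] at hψ
    rcases hψ with rfl | rfl | rfl
    · exact hΓ (hMS1.2.2 (i + 1) (by omega))
    · exact mem 5 (by omega) (Shift.mem_monoLines _ _ _ _)
    · exact mem 3 (by omega) (mr hi)
  · -- 8: disjointness of `R1` and `u_s`
    refine Scaffold.isBlock_of_forall fun θ hθ => ?_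
    obtain ⟨i, hi, rfl⟩ := List.mem_map.1 hθ
    rw [List.mem_range] at hi
    rcases Nat.eq_zero_or_pos i with rfl | hi0
    · refine Or.inr (Sys.glue_infer hGS 3 (by decide) (FregeSystem.sub [K, var (R1 L o s 0), var (uw L o s 0)]) rfl fun ψ hψ => ?_)
      simp only [Sys.glue, List.getElem_cons_succ, List.getElem_cons_zero, Sys.rNAndL, List.mem_singleton] at hψ
      subst hψ; exact mem 6 (by omega) (List.mem_singleton_self _)
    · obtain ⟨j, rfl⟩ : ∃ j, i = j + 1 := ⟨i - 1, by omega⟩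
      refine Or.inr (Sys.glue_infer hGS 4 (by decide) (FregeSystem.sub [K, var (R1 L o s (j + 1)), var (uw L o s (j + 1))]) rfl fun ψ hψ => ?_)
      simp only [Sys.glue, List.getElem_cons_succ, List.getElem_cons_zero, Sys.rNAndR, List.mem_singleton] at hψ
      subst hψ; exact hΓ hz
  · -- 9: disjoint sum
    exact Shift.isBlock_dorLines hGY (hMS2.1.mono hΓ) fun i hi => mem 8 (by omega) (mr hi)
  · -- 10: `s'_0 ↔ u_0`
    refine FregeSystem.IsBlock.singleton (Or.inr (Sys.glue_infer hGS 6 (by decide)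
      (FregeSystem.sub [K, var ((MS2 L o s).S.s 0), var (R1 L o s 0), var (uw L o s 0)]) rfl fun ψ hψ => ?_))
    simp only [Sys.glue, List.getElem_cons_succ, List.getElem_cons_zero, Sys.rOrFL, List.mem_cons, List.not_mem_nil, or_false] at hψ
    rcases hψ with rfl | rfl
    · exact mem 9 (by omega) (Shift.mem_dorLines hL)
    · exact mem 6 (by omega) (List.mem_singleton_self _)
  · -- 11: `s'_{i+1} ↔ R1 (i+1)`
    refine Scaffold.isBlock_of_forall fun θ hθ => ?_
    obtain ⟨i, hi, rfl⟩ := List.mem_map.1 hθ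
    rw [List.mem_range] at hi
    refine Or.inr (Sys.glue_infer hGS 5 (by decide)
      (FregeSystem.sub [K, var ((MS2 L o s).S.s (i + 1)), var (R1 L o s (i + 1)), var (uw L o s (i + 1))]) rfl fun ψ hψ => ?_)
    simp only [Sys.glue, List.getElem_cons_succ, List.getElem_cons_zero, Sys.rOrFR, List.mem_cons, List.not_mem_nil, or_false] at hψ
    rcases hψ with rfl | rfl
    · exact mem 9 (by omega) (Shift.mem_dorLines (by omega))
    · exact hΓ hz
  · -- 12: `s'_i ↔ B' i`
    refine Scaffold.isBlock_of_forall fun θ hθ => ?_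
    obtain ⟨i, hi, rfl⟩ := List.mem_map.1 hθ
    rw [List.mem_range] at hi
    rcases Nat.eq_zero_or_pos i with rfl | hi0
    · rw [eB0]; exact Or.inl (mem 10 (by omega) (List.mem_singleton_self _))
    · obtain ⟨j, rfl⟩ : ∃ j, i = j + 1 := ⟨i - 1, by omega⟩
      exact Or.inr (Logic.infer hGL 6 (by decide) (FregeSystem.sub [K, var ((MS2 L o s).S.s (j + 1)), var (R1 L o s (j + 1)),
        var (B' L o s (j + 1))]) rfl (FregeSystem.prems_cons (mem 11 (by omega) (mr (by omega)))
        (FregeSystem.prems_cons (mem 7 (by omega) (mr (by omega))) FregeSystem.prems_nil)))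
  · -- 13: domination premises for the sum word of `R1 ⊕ u`
    refine Scaffold.isBlock_of_forall fun θ hθ => ?_
    obtain ⟨i, hi, rfl⟩ := List.mem_map.1 hθ
    rw [List.mem_range] at hi
    refine Or.inr (infer hGC 0 (by decide) (FregeSystem.sub [K, var ((MS2 L o s).S.s i), var (B' L o s i)]) rfl fun ψ hψ => ?_)
    simp only [rules, List.getElem_cons_zero, rImpOfBiimp, List.mem_singleton] at hψ
    subst hψ; exact mem 12 (by omega) (mr hi)
  · -- 14: `¬ge(R1 ⊕ u)` by domination
    exact Shift.isBlock_monoLines hGY ((hCAB _ (by omega)).mono hΓ) (hMS2.2.1.mono hΓ) (fun i hi => (nw_ShB hi).symm)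
      (fun i hi => by rw [show (CAB L o (L - s - 1)).x i = B' L o s i from Aw_ShB]; exact mem 13 (by omega) (mr hi)) (hΓ (hltB _ (by omega)))
  · -- 15: `R2 i ↔ B' i`
    refine Scaffold.isBlock_of_forall fun θ hθ => ?_
    obtain ⟨i, hi, rfl⟩ := List.mem_map.1 hθ
    rw [List.mem_range] at hi
    refine Or.inr (infer hGC 1 (by decide) (FregeSystem.sub [K, var (R2 L o s i), var ((MS2 L o s).ge L),
      var ((MS2 L o s).d L i), var ((MS2 L o s).S.s i), var (B' L o s i)]) rfl fun ψ hψ => ?_)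
    simp only [rules, List.getElem_cons_succ, List.getElem_cons_zero, rMuxFChain, List.mem_cons, List.not_mem_nil, or_false] at hψ
    rcases hψ with rfl | rfl | rfl
    · exact hΓ (hMS2.2.2 i hi)
    · exact mem 14 (by omega) (Shift.mem_monoLines _ _ _ _)
    · exact mem 12 (by omega) (mr hi)
  · -- 16: domination premises for `R1`
    refine Scaffold.isBlock_of_forall fun θ hθ => ?_
    obtain ⟨i, hi, rfl⟩ := List.mem_map.1 hθ
    rw [List.mem_range] at hi
    rcases Nat.eq_zero_or_pos i with rfl | hi0
    · refine Or.inr (One.infer hGO 3 (by decide) (FregeSystem.sub [K, var (R1 L o s 0), var (B' L o s 0)]) rfl fun ψ hψ => ?_)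
      simp only [One.rules, List.getElem_cons_succ, List.getElem_cons_zero, One.rImpOfNeg, List.mem_singleton] at hψ
      subst hψ; exact mem 6 (by omega) (List.mem_singleton_self _)
    · obtain ⟨j, rfl⟩ : ∃ j, i = j + 1 := ⟨i - 1, by omega⟩
      refine Or.inr (infer hGC 0 (by decide) (FregeSystem.sub [K, var (R1 L o s (j + 1)), var (B' L o s (j + 1))]) rfl fun ψ hψ => ?_)
      simp only [rules, List.getElem_cons_zero, rImpOfBiimp, List.mem_singleton] at hψ
      subst hψ; exact mem 7 (by omega) (mr (by omega))
  · -- 17: `R1 < n` (the comparator of `LD2_s`'s `VX`)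
    exact Shift.isBlock_monoLines hGY ((hCAB _ (by omega)).mono hΓ) (hCX2.mono hΓ) (fun i hi => (nw_ShB hi).symm)
      (fun i hi => by rw [show (CAB L o (L - s - 1)).x i = B' L o s i from Aw_ShB]; exact mem 16 (by omega) (mr hi)) (hΓ (hltB _ (by omega)))
  · -- 18: domination premises for `u_s`
    refine Scaffold.isBlock_of_forall fun θ hθ => ?_
    obtain ⟨i, hi, rfl⟩ := List.mem_map.1 hθ
    rw [List.mem_range] at hi
    rcases Nat.eq_zero_or_pos i with rfl | hi0
    · rw [eB0]
      exact Or.inr (Sys.glue_infer hGS 12 (by decide) (FregeSystem.sub [K, var (uw L o s 0)]) rfl (by simp [Sys.glue, Sys.rImpRefl]))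
    · obtain ⟨j, rfl⟩ : ∃ j, i = j + 1 := ⟨i - 1, by omega⟩
      refine Or.inr (One.infer hGO 3 (by decide) (FregeSystem.sub [K, var (uw L o s (j + 1)), var (B' L o s (j + 1))]) rfl fun ψ hψ => ?_)
      simp only [One.rules, List.getElem_cons_succ, List.getElem_cons_zero, One.rImpOfNeg, List.mem_singleton] at hψ
      subst hψ; exact hΓ hz
  · -- 19: `u_s < n` (the comparator of `LD2_s`'s `VY`)
    exact Shift.isBlock_monoLines hGY ((hCAB _ (by omega)).mono hΓ) (hCY2.mono hΓ) (fun i hi => (nw_ShB hi).symm)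
      (fun i hi => by rw [show (CAB L o (L - s - 1)).x i = B' L o s i from Aw_ShB]; exact mem 18 (by omega) (mr hi)) (hΓ (hltB _ (by omega)))
  · -- 20: `B_s < n` into `LD1_s`'s `VX`
    exact ModAddU.AssocKit.isBlock_transferLines hGN hGA hGL ((hCAB _ (by omega)).mono hΓ) (hCX1.mono hΓ) (fun i hi => Aw_ShB)
      (fun i hi => nw_ShB hi) (hΓ (hltB _ (by omega)))
  · -- 21: `B_s < n` into `LD1_s`'s `VY`
    exact ModAddU.AssocKit.isBlock_transferLines hGN hGA hGL ((hCAB _ (by omega)).mono hΓ) (hCY1.mono hΓ) (fun i hi => Aw_ShB)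
      (fun i hi => nw_ShB hi) (hΓ (hltB _ (by omega)))
  · -- 22: `a < n` into `M_s`'s comparator
    exact ModAddU.AssocKit.isBlock_transferLines hGN hGA hGL (h.hA.mono hΓ) ((h.hM s hs.le).hCA.mono hΓ) (fun i hi => rfl)
      (fun i hi => rfl) (hΓ hltA)
  · -- 23: `a < n` into `M_{s+1}`'s comparator
    exact ModAddU.AssocKit.isBlock_transferLines hGN hGA hGL (h.hA.mono hΓ) ((h.hM (s + 1) hs).hCA.mono hΓ) (fun i hi => rfl)
      (fun i hi => rfl) (hΓ hltA)

/-- The conclusions of the word facts. [folklore] -/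
theorem mem_segs {s i : ℕ} (hi : i < L) :
    ctx K (eqv (R2 L o s i) (B' L o s i)) ∈ (segs L o K s).flatten ∧
    ctx K (neg (var ((CX2 L o s).ge L L))) ∈ (segs L o K s).flatten ∧
    ctx K (neg (var ((CY2 L o s).ge L L))) ∈ (segs L o K s).flatten ∧
    ctx K (neg (var ((CX1 L o s).ge L L))) ∈ (segs L o K s).flatten ∧
    ctx K (neg (var ((CY1 L o s).ge L L))) ∈ (segs L o K s).flatten ∧
    ctx K (neg (var (((M L o s).CA L).ge L L))) ∈ (segs L o K s).flatten ∧
    ctx K (neg (var (((M L o (s + 1)).CA L).ge L L))) ∈ (segs L o K s).flatten := by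
  have h24 : (segs L o K s).length = 24 := rfl
  have g : ∀ (n : ℕ) (hn : n < 24) {χ : PropForm ℕ}, χ ∈ (segs L o K s)[n]'(by omega) → χ ∈ (segs L o K s).flatten :=
    fun n hn {χ} hχ => List.mem_flatten.2 ⟨_, List.getElem_mem _, hχ⟩
  exact ⟨g 15 (by omega) (List.mem_map.2 ⟨i, List.mem_range.2 hi, rfl⟩), g 17 (by omega) (Shift.mem_monoLines _ _ _ _),
    g 19 (by omega) (Shift.mem_monoLines _ _ _ _), g 20 (by omega) (ModAddU.AssocKit.mem_transferLines _ _ _ _),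
    g 21 (by omega) (ModAddU.AssocKit.mem_transferLines _ _ _ _), g 22 (by omega) (ModAddU.AssocKit.mem_transferLines _ _ _ _),
    g 23 (by omega) (ModAddU.AssocKit.mem_transferLines _ _ _ _)⟩

/-- **Every line of the word facts has size `≤ |K| + 40`.** [folklore] -/
theorem bounded_segs (L : ℕ) (o : Occ) (K : PropForm ℕ) (s : ℕ) : ModAddU.Bounded (K.size + 40) (segs L o K s).flatten := by
  have hM : Sys.MONO.inv.size ≤ 36 := by decide +kernel
  have hD : Sys.DOR.inv.size ≤ 8 := by decide +kernel
  have hmono : ∀ A X, ModAddU.Bounded (K.size + 40) (Shift.monoLines A X K L) := fun A X =>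
    (ModAddU.bounded_sysLines (B := K.size + 40) _ _ _ _ (by omega)).append
      (ModAddU.Bounded.singleton (by rw [ModAddU.size_ctx, ModAddU.size_inst]; simp [size]))
  refine ModAddU.Bounded.flatten fun D hD' => ?_
  simp only [segs, List.mem_cons, List.not_mem_nil, or_false] at hD'
  rcases hD' with rfl | rfl | rfl | rfl | rfl | rfl | rfl | rfl | rfl | rfl | rfl | rfl | rfl | rfl | rfl | rfl | rfl | rfl | rfl | rfl |
    rfl | rfl | rfl | rfl
  · exact ModAddU.bounded_ctx_eqv _ (by omega) _ _ _
  · exact ModAddU.bounded_ctx_eqv _ (by omega) _ _ _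
  · exact ModAddU.Bounded.singleton (by rw [ModAddU.size_ctx]; simp [size])
  · exact ModAddU.bounded_ctx_eqv _ (by omega) _ _ _
  · exact ModAddU.Bounded.map fun i _ => by rw [ModAddU.size_ctx]; simp [size]
  · exact hmono _ _
  · exact ModAddU.Bounded.singleton (by rw [ModAddU.size_ctx]; simp [size])
  · exact ModAddU.bounded_ctx_eqv _ (by omega) _ _ _
  · exact ModAddU.Bounded.map fun i _ => by rw [ModAddU.size_ctx]; simp [size]
  · exact (ModAddU.bounded_sysLines (B := K.size + 40) _ _ _ _ (by omega)).append
      (ModAddU.Bounded.map fun i _ => by rw [ModAddU.size_ctx, ModAddU.size_inst]; simp [size, FregeSystem.size_biimp])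
  · exact ModAddU.Bounded.singleton (by rw [ModAddU.size_ctx, FregeSystem.size_eqv]; omega)
  · exact ModAddU.bounded_ctx_eqv _ (by omega) _ _ _
  · exact ModAddU.bounded_ctx_eqv _ (by omega) _ _ _
  · exact ModAddU.Bounded.map fun i _ => by rw [ModAddU.size_ctx]; simp [size]
  · exact hmono _ _
  · exact ModAddU.bounded_ctx_eqv _ (by omega) _ _ _
  · exact ModAddU.Bounded.map fun i _ => by rw [ModAddU.size_ctx]; simp [size]
  · exact hmono _ _
  · exact ModAddU.Bounded.map fun i _ => by rw [ModAddU.size_ctx]; simp [size]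
  · exact hmono _ _
  iterate 4 · exact ModAddU.MFI.bounded_transfer _ _ _ _ (by omega)

/-- The word facts have at most `38L + 20` lines. [folklore] -/
theorem length_segs_flatten_le (L : ℕ) (o : Occ) (K : PropForm ℕ) (s : ℕ) : (segs L o K s).flatten.length ≤ 38 * L + 20 := by
  simp only [segs, List.flatten_cons, List.flatten_nil, List.length_append, List.length_map, List.length_range,
    List.length_cons, List.length_nil, List.append_nil, Shift.monoLines, Shift.dorLines, System.lines,
    LD.length_transferLines]
  omega

/-- **Size of the word facts**: `≤ (38L + 20)(|K| + 40)`. [folklore] -/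
theorem proofSize_segs (L : ℕ) (o : Occ) (K : PropForm ℕ) (s : ℕ) :
    proofSize (segs L o K s).flatten ≤ (38 * L + 20) * (K.size + 40) :=
  (bounded_segs L o K s).proofSize_le.trans (Nat.mul_le_mul_right _ (length_segs_flatten_le L o K s))

end Comm

end ModMulU

end Literature.Computability.MetaComplexity
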